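import Summits.BirchSwinnertonDyer.BirchSwinnertonDyer.Theorems.CMKolyvaginAtInertTwoShaCountCompositeTwistAtTwo
import HarnessLib

/-!
# Route `GenusKolyvaginAtTwo`, crux U₂ `MinimalTwinBSDTwo` (stmt-BirchSwinnertonDyer-22985), LINE 23 «twin_swap» — THE GENUS BUDGET IN FROBENIUS TERMS:
# on the odd habitat cut `v₂ C(W^{(d_K)}) = #{q ∣ d_K : (Δ/q) = −1} + 2·#{q ∣ d_K : (Δ/q) = +1, a_q even}`, so the budget clause of NVDOOR / FRAME is
# a Chebotarev condition on the prime factors of `d_K`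

Seat `bsd-line-gk2-p2` g33 (PROVER seat 2/3, cell `bsd-f1-sign2`, LINE 23 holder), `--supports stmt-BirchSwinnertonDyer-22985 --as helper`.
THEOREMS ONLY (no definition, no named fact, no `sorry`).  BSD is NOT proved by any of this; U₂ is NOT proved; nothing is closed.

WHAT.  LINE 23's frame leaf (NVDOOR, p818043; FRAME♭/FRAME♮ before it) asks for a globally minimal twin model `Wd ≅ W^{(d_K)}` INSIDE THE GENUS BUDGET
`(Δ_W < 0 ∧ v₂ C(Wd) ≤ 1) ∨ v₂ C(Wd) = 0`.  The tree (cell `bsd-print-cf2`, `ShaCountTwo.padicValNat_two_tamagawaProduct_twist_of_heegner`, NOT CM-specific)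
computes, for EVERY odd Heegner `d_K` and any model of the twist: `v₂ C(Wd) = v₂ C(W) + Σ_{q ∣ d_K} ([(Δ/q) = −1] + 2·[(Δ/q) = 1 ∧ a_q even])`
(Kramer 1981 Prop. 3: at `q ∣ d_K` the twist is `I₀*` with `c_q = #Ẽ(𝔽_q)[2]`).  On the cut `C(W)` is odd, so the budget is a condition on the Frobenius
classes of the prime factors of `d_K` in `Gal(ℚ(W[2])/ℚ) ≅ S₃` alone: no `q` with three roots of the `2`-division cubic (`(Δ/q) = 1 ∧ a_q` even), and at
most `𝟙[Δ < 0]` primes with exactly one root (`(Δ/q) = −1`).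
* §1 `padicValNat_two_tamagawaProduct_twist_eq_sum_of_odd` — the identity with `v₂ C(W) = 0`.
* §2 `genusBudget_of_frobenius` — the Frobenius conditions IMPLY the budget; `frobenius_of_genusBudget` — and are IMPLIED by it: the budget clause IS
  «`∀ q ∣ d_K, ¬((Δ/q) = 1 ∧ 2 ∣ a_q)` and `#{q ∣ d_K : (Δ/q) = −1} ≤ 𝟙[Δ_W < 0]`» (`genusBudget_iff_frobenius`).
* §3 `exists_budgetTwinModel_of_frobenius` — with the tree's globally minimal twist model (`ShaCountTwo.exists_isGloballyMinimal_twist_of_heegner`): the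
  Frobenius conditions produce the «`∃ Wd` globally minimal in budget» conjunct of NVDOOR verbatim.  So NVDOOR's analytic clause reads: ONE imaginary
  quadratic Heegner `K` (`d_K` odd `≠ −3`) with `L(W^{(d_K)},1) ≠ 0` whose ramified primes avoid the totally split class of `ℚ(W[2])` and meet the
  transposition class at most `𝟙[Δ_W < 0]` times — a twist non-vanishing statement inside a Chebotarev-type class, as an analyst would state it.

HONEST FRAMING.  Bookkeeping over a tree theorem; nothing beyond print; CONDITIONAL on nothing new; BSD is NOT proved.

References: [Kramer1981] Prop. 3; [BoxerDiao2010] proof of Prop. 4.1; [JetchevSkinnerWan2017] §7.4.1.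
-/

set_option autoImplicit false
set_option linter.dupNamespace false -- `Summit.<P>.<Sub>` repeats `BirchSwinnertonDyer` (D-0017)

noncomputable section

open scoped Classical

namespace Summit.BirchSwinnertonDyer.BirchSwinnertonDyer.Theorems.GenusExact.TwinSwap.GenusBudget

open Literature.NumberTheory.EllipticCurves WeierstrassCurve NumberField
open Summit.BirchSwinnertonDyer.BirchSwinnertonDyer.Theorems.ShaCountTwo
  (padicValNat_two_tamagawaProduct_twist_of_heegner exists_isGloballyMinimal_twist_of_heegner)

variable (W : WeierstrassCurve ℚ) [W.IsElliptic] [W.IsGloballyMinimal]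
  (K : Type) [Field K] [NumberField K] (hK : IsImaginaryQuadratic K)
  (hodd : Odd (NumberField.discr K)) (hH : SatisfiesHeegnerHypothesis (W.conductorNorm ℤ) K)
  {Wd : WeierstrassCurve ℚ} [Wd.IsElliptic] (Cd : VariableChange ℚ)
  (hWd : Cd • W.quadraticTwist (NumberField.discr K : ℚ) = Wd)

/-! ## §1 The identity on the odd habitat cut -/

/-- For a finset sum of indicator-type terms: `Σ_{q∈T} ([A q] + 2·[B q]) = #(T.filter A) + 2·#(T.filter B)` (private helper). [folklore] -/
private theorem sum_ite_add_two_ite_eq (T : Finset ℕ) (A B : ℕ → Prop) [DecidablePred A] [DecidablePred B] :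
    ∑ q ∈ T, ((if A q then 1 else 0) + (if B q then 2 else 0)) = (T.filter A).card + 2 * (T.filter B).card := by
  rw [Finset.sum_add_distrib, Finset.card_filter, Finset.card_filter, Finset.mul_sum]
  congr 1
  refine Finset.sum_congr rfl fun q _ ↦ ?_
  split_ifs <;> simp

include hK hodd hH hWd in
/-- **The `2`-adic Tamagawa product of the Heegner twist on the odd habitat cut.**  For `W/ℚ` globally minimal with `C(W)` odd, `K` imaginary quadratic with
`d_K` odd satisfying the Heegner hypothesis for `N_W`, and ANY equation `Wd = Cd • W^{(d_K)}` of the twist: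
**`v₂ C(Wd) = #{q ∣ d_K : (Δ/q) = −1} + 2 · #{q ∣ d_K : (Δ/q) = +1 ∧ a_q(W) even}`** (`Δ = W.Δ.num` the minimal discriminant; the sets run over
the prime factors of `|d_K|`): the tree's `ShaCountTwo.padicValNat_two_tamagawaProduct_twist_of_heegner` with `v₂ C(W) = 0`.  Dictionary (`q ∣ d_K` is
a good odd prime of `W`): `(Δ/q) = −1` iff the `2`-division cubic has exactly one root mod `q` (Frob_q a transposition on `W[2]`), `(Δ/q) = 1 ∧ a_q`
even iff three roots (Frob_q trivial), otherwise no root (a `3`-cycle). [cite: Kramer1981, Prop. 3] [cite: BoxerDiao2010, proof of Prop. 4.1 (p. 1977)] -/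
theorem padicValNat_two_tamagawaProduct_twist_eq_card_of_odd (hT : Odd W.tamagawaProduct) :
    padicValNat 2 Wd.tamagawaProduct =
      ((NumberField.discr K).natAbs.primeFactors.filter (fun q ↦ jacobiSym W.Δ.num q = -1)).card +
        2 * ((NumberField.discr K).natAbs.primeFactors.filter (fun q ↦ jacobiSym W.Δ.num q = 1 ∧ Even (W.frobeniusTrace q))).card := by
  haveI : Fact (Nat.Prime 2) := ⟨Nat.prime_two⟩
  have h0 : padicValNat 2 W.tamagawaProduct = 0 :=
    padicValNat.eq_zero_of_not_dvd fun h ↦ (Nat.not_even_iff_odd.mpr hT) (even_iff_two_dvd.mpr h)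
  rw [padicValNat_two_tamagawaProduct_twist_of_heegner W K hK hodd hH Cd hWd, h0, zero_add]
  exact sum_ite_add_two_ite_eq _ _ _

/-! ## §2 The genus budget IS a Frobenius condition on the prime factors of `d_K` -/

include hK hodd hH hWd in
/-- **Frobenius conditions ⟹ genus budget.**  On the odd habitat cut (`C(W)` odd), at an odd Heegner frame `K`: if NO prime factor `q` of `d_K` has
`(Δ/q) = 1 ∧ a_q(W)` even (three roots of the `2`-division cubic mod `q`) and the number of prime factors with `(Δ/q) = −1` (one root) is at most
`𝟙[Δ_W < 0]`, then every equation `Wd` of `W^{(d_K)}` lies in the genus budget `(Δ_W < 0 ∧ v₂ C(Wd) ≤ 1) ∨ v₂ C(Wd) = 0`.  At a PRIME frame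
`d_K = −ℓ₀` this is p813652's «budget automatic»: `(Δ/ℓ₀) = sign Δ` there. [cite: Kramer1981, Prop. 3] -/
theorem genusBudget_of_frobenius (hT : Odd W.tamagawaProduct)
    (hno3 : ∀ q ∈ (NumberField.discr K).natAbs.primeFactors, ¬ (jacobiSym W.Δ.num q = 1 ∧ Even (W.frobeniusTrace q)))
    (hcount : ((NumberField.discr K).natAbs.primeFactors.filter (fun q ↦ jacobiSym W.Δ.num q = -1)).card ≤ if W.Δ < 0 then 1 else 0) :
    (W.Δ < 0 ∧ padicValNat 2 Wd.tamagawaProduct ≤ 1) ∨ padicValNat 2 Wd.tamagawaProduct = 0 := by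
  have h3 : ((NumberField.discr K).natAbs.primeFactors.filter
      (fun q ↦ jacobiSym W.Δ.num q = 1 ∧ Even (W.frobeniusTrace q))).card = 0 := by
    rw [Finset.card_eq_zero, Finset.filter_eq_empty_iff]
    exact fun q hq ↦ hno3 q hq
  have hv := padicValNat_two_tamagawaProduct_twist_eq_card_of_odd W K hK hodd hH Cd hWd hT
  rw [h3, mul_zero, add_zero] at hv
  by_cases hΔ : W.Δ < 0
  · rw [if_pos hΔ] at hcount
    exact Or.inl ⟨hΔ, hv ▸ hcount⟩
  · rw [if_neg hΔ, Nat.le_zero] at hcount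
    exact Or.inr (hv.trans hcount)

include hK hodd hH hWd in
/-- **Genus budget ⟹ Frobenius conditions** (the converse): if some equation `Wd` of `W^{(d_K)}` lies in the budget, then no prime factor of `d_K` is
totally split in `ℚ(W[2])` (`(Δ/q) = 1 ∧ a_q` even) and at most `𝟙[Δ_W < 0]` of them are transposition primes (`(Δ/q) = −1`). [cite: Kramer1981, Prop. 3] -/
theorem frobenius_of_genusBudget (hT : Odd W.tamagawaProduct)
    (hbudget : (W.Δ < 0 ∧ padicValNat 2 Wd.tamagawaProduct ≤ 1) ∨ padicValNat 2 Wd.tamagawaProduct = 0) :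
    (∀ q ∈ (NumberField.discr K).natAbs.primeFactors, ¬ (jacobiSym W.Δ.num q = 1 ∧ Even (W.frobeniusTrace q))) ∧
      ((NumberField.discr K).natAbs.primeFactors.filter (fun q ↦ jacobiSym W.Δ.num q = -1)).card ≤ if W.Δ < 0 then 1 else 0 := by
  have hv := padicValNat_two_tamagawaProduct_twist_eq_card_of_odd W K hK hodd hH Cd hWd hT
  have hle1 : padicValNat 2 Wd.tamagawaProduct ≤ 1 := by
    rcases hbudget with ⟨-, h⟩ | h
    · exact h
    · omega
  have h3 : ((NumberField.discr K).natAbs.primeFactors.filter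
      (fun q ↦ jacobiSym W.Δ.num q = 1 ∧ Even (W.frobeniusTrace q))).card = 0 := by omega
  refine ⟨fun q hq hbad ↦ ?_, ?_⟩
  · rw [Finset.card_eq_zero, Finset.filter_eq_empty_iff] at h3
    exact h3 hq hbad
  · split_ifs with hΔ
    · omega
    · rcases hbudget with ⟨h, -⟩ | h
      · exact absurd h hΔ
      · omega

include hK hodd hH hWd in
/-- **The genus budget clause IS the Frobenius condition** (§2 both ways). [cite: Kramer1981, Prop. 3] -/
theorem genusBudget_iff_frobenius (hT : Odd W.tamagawaProduct) :
    ((W.Δ < 0 ∧ padicValNat 2 Wd.tamagawaProduct ≤ 1) ∨ padicValNat 2 Wd.tamagawaProduct = 0) ↔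
      ((∀ q ∈ (NumberField.discr K).natAbs.primeFactors, ¬ (jacobiSym W.Δ.num q = 1 ∧ Even (W.frobeniusTrace q))) ∧
        ((NumberField.discr K).natAbs.primeFactors.filter (fun q ↦ jacobiSym W.Δ.num q = -1)).card ≤ if W.Δ < 0 then 1 else 0) :=
  ⟨frobenius_of_genusBudget W K hK hodd hH Cd hWd hT, fun h ↦ genusBudget_of_frobenius W K hK hodd hH Cd hWd hT h.1 h.2⟩

/-! ## §3 The «globally minimal twin model in budget» conjunct of NVDOOR from the Frobenius conditions -/

include hK hodd hH in
omit [Wd.IsElliptic] in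
/-- **The budget twin model from Frobenius data.**  On the odd habitat cut, at an odd Heegner frame whose ramified primes satisfy the Frobenius
conditions of §2, the twist `W^{(d_K)}` has a globally minimal model inside the genus budget — VERBATIM the «`∃ Wd`» conjunct of NVDOOR (p818043) /
FRAME♭ / FRAME♮ (the tree's globally minimal twist model `ShaCountTwo.exists_isGloballyMinimal_twist_of_heegner`, then §2).  So the analytic clause of
LINE 23's frame leaf reads: ONE imaginary quadratic Heegner `K` (`d_K` odd `≠ −3`) with `L(W^{(d_K)},1) ≠ 0` whose ramified primes avoid the totally
split class of `ℚ(W[2])/ℚ` and meet the transposition class at most `𝟙[Δ_W < 0]` times.  BSD is NOT proved. [cite: Kramer1981, Prop. 3]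
[cite: SilvermanAEC2009, VII.1 Remark 1.1] -/
theorem exists_budgetTwinModel_of_frobenius (hT : Odd W.tamagawaProduct)
    (hno3 : ∀ q ∈ (NumberField.discr K).natAbs.primeFactors, ¬ (jacobiSym W.Δ.num q = 1 ∧ Even (W.frobeniusTrace q)))
    (hcount : ((NumberField.discr K).natAbs.primeFactors.filter (fun q ↦ jacobiSym W.Δ.num q = -1)).card ≤ if W.Δ < 0 then 1 else 0) :
    ∃ (Wd : WeierstrassCurve ℚ) (_ : Wd.IsElliptic) (_ : Wd.IsGloballyMinimal),
      (∃ C : VariableChange ℚ, C • W.quadraticTwist (NumberField.discr K : ℚ) = Wd) ∧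
        ((W.Δ < 0 ∧ padicValNat 2 Wd.tamagawaProduct ≤ 1) ∨ padicValNat 2 Wd.tamagawaProduct = 0) := by
  obtain ⟨Wd, Cd, hCd, -, hE, hM⟩ := exists_isGloballyMinimal_twist_of_heegner W K hK hodd hH
  haveI := hE
  exact ⟨Wd, hE, hM, ⟨Cd, hCd⟩, genusBudget_of_frobenius W K hK hodd hH Cd hCd hT hno3 hcount⟩

include hK hodd hH in
omit [Wd.IsElliptic] in
/-- **Conversely every budget twin model certifies the Frobenius conditions** — so on the odd habitat cut the two forms of the frame leaf's local clause
are EQUIVALENT: `(∃ Wd globally minimal ≅ W^{(d_K)} in budget) ↔ (Frobenius conditions on the prime factors of d_K)`. [cite: Kramer1981, Prop. 3] -/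
theorem exists_budgetTwinModel_iff_frobenius (hT : Odd W.tamagawaProduct) :
    (∃ (Wd : WeierstrassCurve ℚ) (_ : Wd.IsElliptic) (_ : Wd.IsGloballyMinimal),
      (∃ C : VariableChange ℚ, C • W.quadraticTwist (NumberField.discr K : ℚ) = Wd) ∧
        ((W.Δ < 0 ∧ padicValNat 2 Wd.tamagawaProduct ≤ 1) ∨ padicValNat 2 Wd.tamagawaProduct = 0)) ↔
      ((∀ q ∈ (NumberField.discr K).natAbs.primeFactors, ¬ (jacobiSym W.Δ.num q = 1 ∧ Even (W.frobeniusTrace q))) ∧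
        ((NumberField.discr K).natAbs.primeFactors.filter (fun q ↦ jacobiSym W.Δ.num q = -1)).card ≤ if W.Δ < 0 then 1 else 0) := by
  refine ⟨?_, fun h ↦ exists_budgetTwinModel_of_frobenius W K hK hodd hH hT h.1 h.2⟩
  rintro ⟨Wd, hE, -, ⟨Cd, hCd⟩, hbudget⟩
  haveI := hE
  exact frobenius_of_genusBudget W K hK hodd hH Cd hCd hT hbudget

end Summit.BirchSwinnertonDyer.BirchSwinnertonDyer.Theorems.GenusExact.TwinSwap.GenusBudget

end
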